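import Summits.QuantumFields.BalabanUV.Beta.GAN24.WrecAtEvenHalfRowsOfWardLetters
import Summits.QuantumFields.BalabanUV.Beta.GAN24.WSlotParityJunctionLetters
import Summits.QuantumFields.BalabanUV.Beta.GAN24.CombPinLockScalar

/-!
# `BalabanUV.Beta.GAN24.WrecAtEvenHalfRowsOfBorderLetters` — binder row G-an2-4 ∕ (CONV-C), W-slot EXIT (α) (the (α-0) parity re-cut), THE CAPSTONE ONE LEVEL DOWN ON THE D1 SIDE:
# **ROAD FP's D1 LITERAL OF RECORD ⟸ an1's BORDER LETTERS (both slots, every level) AND MIXED LETTER (every level) — the D1 lane's own letters of record —, THE (Q-L) LEG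
# LETTERS AND THEIR DRIFTS, AND (C)sym; D1's RAW W-SLOT TABLE LAWS `hTL ∕ hTL″`, THE RESIDUAL PARITIES `hR ∕ hR″`, THE LOCK `hlock` AND THE THREE SCALAR ROWS ALL DISCHARGED**
# — leaf-01 g73's PART D `WrecAtEvenHalfRowsOfWardLetters` at the PINNED lock constants (MY `CombPinLockScalar` §3), its table-law displays supplied level by level by
# d1-leaf-06's `WardLocusQuarticTable.tableLaw_T2RecAt_zero ∕ _succ` (+ `''` twins) fed with (i) the tree's ALL-LEVELS KERNEL LAW of the W-literal with its residual tower in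
# vertex form and its parities — the chair g38's `WardResidualSRecursionAll` ⨾ g44's `WardResidualParity` ⨾ leaf-01 g71's `WSlotParityJunctionLetters.exists_kernelLaws_vertexForm_parity_TW_su`
# (Wilson letters DISCHARGED for `SU(N)`, `N ≥ 2`: leaf-09 ∕ d1-leaf-06's `WilsonWardColourFree`) —, (ii) d1-leaf-06's `lock_succ_of_pin` (the lock at `cE₂ = Lc^8` IS the
# pinned constant — `CombPinLockScalar.lock_pin_iff_three`), (iii) the Wilson letters at level 0; the residual words `R ∕ R″` := (table law's left side) − (commutator word),
# so `hTL ∕ hTL″` become identities and `hR ∕ hR″` are READ OFF the table laws: level 0 = border remainder (odd by `hRBp`), level m+1 = the sandwiched kernel-law residual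
# `−(cH′·cE₂·wV4) • Σ_v mmRead (G_m ∘ 𝒩_m ∘ G_m) + RB (m+1)` (odd: an1's `parityOdd_sandwich` ⨾ `parityOdd_mmRead` on the sgn-symmetric spread `G_m`, `𝒩_m` localised and odd
# by (P-Φ) ∕ (P-Ψ) ⨾ `trK_vertexOfK_eq_neg_sgnK_of_rows`) — leaf-01 g72's `HalfMemberSlavedDivergencePin` §4 pattern, here at the literal and for ALL levels at once
# (road-P2 chair of row G-an2-4, unit `b2b-balaban-gan24-p2` gen 46, crux team (2))

NOT IN PRINT; OUR BOOKKEEPING ([folklore] ONE composition BY NAME; 0 `def`, 0 cited facts, 0 `def … : Prop`, 0 sorry).  HONEST FRAMING (cell contract, verbatim): «discharging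
`BetaPertH` makes Bałaban's UV stability UNCONDITIONAL — a real constructive-QFT result; it is NOT the continuum limit and NOT the Clay problem.»  HONEST DEPENDENCY (verbatim):
«continuum YM on T⁴ ⇐ BetaPertH ∧ nine spine estimates (0/9 proved); BetaPertH ⇐ (D1) ∧ (D4) ∧ CAP+tail; G-an2-4 gates asym, D1 and NE2/3/4.»

WHAT: **`exists_allScalesSeq_JsRowD1Pin_of_borderLetters`** (`Lc` odd, `Lc ≥ 2`, colour `SU(N)` with `2 ≤ N`, every channel `μ ν`; the literal's tables pinned by PART D's EIGHT displayed
equations, `cE ∕ cVH ∕ cE₂` spelled as the D1 lane spells them: `Lc^{3+1}`, `−(Lc^{3+1}·½·Lc^{3+1})`, `Lc^{2(3+1)}`): `∃ κ θ, 0 ≤ θ < 1 ∧ AllScalesSeq (j ↦ secondMoment (TbalOf Lc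
(JsRowD1Pin hLc N) j) μ ν) κ θ` ⟸ THE DISPLAYED LIST, AND NOTHING ELSE: an1's BORDER letters `hBord0 hBord0″ hBordS hBordS″` and MIXED letter `hM₂` at the pinned lock constants
`(stepScale 3 Lc j · Lc^{3+1})⁻¹` with remainders `RB RB″ RM` (their per-level classes `hcls0 hclsS` and row parities `hRBp hRB″p hRMp`) — BYTE-FOR-BYTE the letter binders of
`exists_kernelLaws_vertexForm_parity_TW_su` at `d = 3` (= the D1 lane's `RowD1JointEnd` letters of record; at the literal of record `RB = RB″ = 0`, `RM = 0`); THE (Q-L) LEG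
LETTERS `hL₁ hL₂` and drifts `hL₁′ hL₂′` (PART D verbatim); (C)sym `hS` (PART D verbatim).  GONE relative to PART D: `cH hcH0 c₀ hcH hq` (the pin) AND `R R″ hTL hTL″ hR hR″`
(D1's raw table laws and their residual parities — now consequences of the letters).  READING: the G-an2-4 side of road FP's D1 literal displays EXACTLY {(Q-L) letters +
drifts, (C)sym} and, on the D1 side, EXACTLY the D1 lane's own letters of record (border ×4, mixed ×1) — no table law, no lock, no scalar.  Discharges NOTHING of (Q-L) ∕
(C)sym ∕ an1's letters ∕ (hW, hWall) unconditionally; (β) of record untouched (the residual tower is parity-odd and never read — the (α-0) re-cut); NEVER «G-an2-4 closed» as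
(CONV-C); NOT D1, NOT `BetaPertH`, NOT continuum, NOT Clay.  2026-08-23; no existing file touched.
-/

noncomputable section

open Finset
open scoped BigOperators
open Literature.MathematicalPhysics.QuantumFieldTheory
open Literature.MathematicalPhysics.QuantumFieldTheory.Balaban1983to89
open Literature.MathematicalPhysics.QuantumFieldTheory.Balaban1983to89.Beta
open ExpKernelCalculus (MKer shiftK BiLoc Decays comp)
open OneStepResolventKernel (Fib LocStencil)
open OneStepKernelFamily (KInvStep TbalOf)
open RemainderConstAllScales (AllScalesSeq)
open AveragingContoursRooted (ctrOff ctrOff_mem_box)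
open WilsonVertex2Sym (wsym22)
open AffineAveraging (box toSite unitVec)
open AveragingMixedJetTables (mixFFAt)
open SecondOrderResponse (W2SymOfK)
open KernelWard (divV)
open BalabanCompositeJets (LocStencil₂)
open BalabanStepJetsSucc (mmRead)
open BalabanStepW2 (K3OfK M2Of)
open Summit.QuantumFields.BalabanUV.Beta.TameKernelCalculus (trK)
open Summit.QuantumFields.BalabanUV.Beta.BorderedHessian (sgnK diagK)
open Summit.QuantumFields.BalabanUV.Beta.AveragingWardRootedStencils (legInd)
open Summit.QuantumFields.BalabanUV.Beta.HessKerDressedUnits (unitK unitS)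
open Summit.QuantumFields.BalabanUV.Beta.SecondOrderUnits (unitM unitS₂ unitM₂)
open Summit.QuantumFields.BalabanUV.Beta.AxialDressingRooted (coDressKBmAt)
open Summit.QuantumFields.BalabanUV.Beta.SpineRooted (T2RecOf T2RecAt SpureRecAt M1At e3OfK)
open Summit.QuantumFields.BalabanUV.Beta.SecondOrderSocketIdentification (vh₂SAn1 vh₂SAn1_inl_inl vh₂SAn1_inr_inr)
open Summit.QuantumFields.BalabanUV.Beta.SecondOrderTableLawEnd (locStencil₂_vh₂SAn1 vh₂SAn1_translate)
open Summit.QuantumFields.BalabanUV.Beta.RowD1JointEnd (JsRowD1Pin)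
open Summit.QuantumFields.BalabanUV.Beta.GAN24.CombesThomas (sfStep smStep)
open Summit.QuantumFields.BalabanUV.Beta.GAN24.T2RecursionAffine (lin4)
open Summit.QuantumFields.BalabanUV.Beta.GAN24.BiStencilZeroMode (zmode)
open Summit.QuantumFields.BalabanUV.Beta.GAN24.RowCChargeForms (hC_halfMember_of_CSym_three)
open Summit.QuantumFields.BalabanUV.Beta.GAN24.T2ShapeEvenMemberOfWardLetters (t2ShapeEven_three_of_wardLetters_junction)
open Summit.QuantumFields.BalabanUV.Beta.GAN24.T2DriftEvenMemberOfWardLetters (t2DriftEven_three_of_wardLetters_junction)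
open Summit.QuantumFields.BalabanUV.Beta.GAN24.WrecAtEvenHalfRowsFinal (exists_allScalesSeq_JsRowD1Pin_of_T2ev)

open OneStepResolventKernel (LocStencil)
open OneStepKernelFamily (vertexOfK)
open ExpKernelCalculus (VertexFamily)
open SecondOrderResponse (LocStencilFM)
open BalabanStepJetsSucc (wE wVH)
open BalabanStepW2 (wV4 wB2)
open AveragingHessianKernelsRooted (vhSAt)
open Summit.QuantumFields.BalabanUV.Beta.TameKernelCalculus (Loc Spr)
open Summit.QuantumFields.BalabanUV.Beta.BorderedHessian (stepScale)
open Summit.QuantumFields.BalabanUV.Beta.AxialDressingRooted (decays_coDressKBmAt_KInvStep)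
open Summit.QuantumFields.BalabanUV.Beta.MixedJetTablesPlug (hmix_an1)
open Summit.QuantumFields.BalabanUV.Beta.WardLocusQuarticTable (tableLaw_T2RecAt_succ tableLaw_T2RecAt_succ'' tableLaw_T2RecAt_zero tableLaw_T2RecAt_zero'' lock_succ_of_pin)
open Summit.QuantumFields.BalabanUV.Beta.WilsonWardColourFree (hWil_wilson_TW_su hWil''_wilson_TW_su)
open Summit.QuantumFields.BalabanUV.Beta.BubbleParity (spr_of_decays trK_coDressKBmAt_KInvStep)
open Summit.QuantumFields.BalabanUV.Beta.KernelWardRemainderParity (parityOdd_add trK_vertexOfK_eq_neg_sgnK_of_rows)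
open Summit.QuantumFields.BalabanUV.Beta.SpineRecursiveParity (parityOdd_smul parityOdd_sum parityOdd_mmRead parityOdd_sandwich)
open Summit.QuantumFields.BalabanUV.Beta.GAN24.WardResidualParity (parityOdd_zero_family)
open Summit.QuantumFields.BalabanUV.Beta.GAN24.WSlotParityJunctionLetters (exists_kernelLaws_vertexForm_parity_TW_su)
open Summit.QuantumFields.BalabanUV.Beta.GAN24.CombPinLockScalar (hcH0_pin_three hcH_pin_three hq_pin_three)
open Summit.QuantumFields.BalabanUV.Beta.GAN24.WrecAtEvenHalfRowsOfWardLetters (exists_allScalesSeq_JsRowD1Pin_of_wardLetters)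

namespace Summit.QuantumFields.BalabanUV.Beta.GAN24.WrecAtEvenHalfRowsOfBorderLetters

variable {Lc : ℕ} [NeZero Lc]

/-- NOT IN PRINT; OUR BOOKKEEPING.  **THE D1 LITERAL FROM an1's BORDER + MIXED LETTERS, THE (Q-L) LEG LETTERS (AND DRIFTS) AND (C)sym — D1's TABLE LAWS, RESIDUAL PARITIES, LOCK
AND SCALAR ROWS DISCHARGED** (see the module docstring for the composition). -/
theorem exists_allScalesSeq_JsRowD1Pin_of_borderLetters (hLc : Odd Lc) (hL2 : 2 ≤ Lc) {N : ℕ} (hN : 2 ≤ N) {r : Fin (3 + 1) → ℕ} (hr : r = ctrOff (3 + 1) Lc)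
    {cE cVH cΛ cE₂ cB : ℝ} (hcE : cE = (Lc : ℝ) ^ (3 + 1)) (hcVH : cVH = -((Lc : ℝ) ^ (3 + 1) * (1 / 2) * (Lc : ℝ) ^ (3 + 1))) (hcΛ : cΛ = 2 / (Lc : ℝ) ^ 4) (hcE₂ : cE₂ = (Lc : ℝ) ^ (2 * (3 + 1)))
    (hcB : cB = -((Lc : ℝ) ^ 12 / 4)) {Tc : Fin 4 → Fin 4 → Fin 4 → Fin 4 → ℝ} (hTc : Tc = (8 * (N : ℝ) ^ 2)⁻¹ • wsym22 N)
    {vh₂S : Fin (3 + 1) → (Fin (3 + 1) → ℤ) → Fin (3 + 1) → (Fin (3 + 1) → ℤ) → MKer (3 + 1) (Fib 3)} (hvh : vh₂S = vh₂SAn1 Lc)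
    {RB RB'' : ℕ → (Fin (3 + 1) → ℤ) → Fin (3 + 1) → (Fin (3 + 1) → ℤ) → MKer (3 + 1) (Fib 3)} {RM : ℕ → (Fin (3 + 1) → ℤ) → Fin (3 + 1) → (Fin (3 + 1) → ℤ) → MKer (3 + 1) (Fib 3)}
    (hcls0 : ∃ C δ : ℝ, 0 < δ ∧ (∀ Y, LocStencil (RB 0 Y) C δ) ∧ (∀ Y, LocStencil (RB'' 0 Y) C δ) ∧ (∀ y, VertexFamily (RM 0 y) Lc C δ))
    (hclsS : ∀ j : ℕ, ∃ C δ : ℝ, 0 < δ ∧ (∀ Y, LocStencil (RB (j + 1) Y) C δ) ∧ (∀ Y, LocStencil (RB'' (j + 1) Y) C δ) ∧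
      (∀ y, VertexFamily (RM (j + 1) y) Lc C δ))
    -- the three remaining letter-remainder ROW PARITIES (the Wilson letters are EXACT at `T_W`: `RW = RW″ = 0`)
    (hRBp : ∀ j Y κ u, trK (RB j Y κ u) = -sgnK (RB j Y κ u)) (hRB''p : ∀ j Y κ u, trK (RB'' j Y κ u) = -sgnK (RB'' j Y κ u))
    (hRMp : ∀ j y ρ w, trK (RM j y ρ w) = -sgnK (RM j y ρ w))
    (hBord0 : ∀ (Y : Fin (3 + 1) → ℤ) (κ' : Fin (3 + 1)) (u' : Fin (3 + 1) → ℤ),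
      (stepScale 3 Lc 0 * (Lc : ℝ) ^ (3 + 1))⁻¹ • ∑ v ∈ box (3 + 1) Lc, divV (fun κ u => cB • vh₂S κ u κ' u') ((Lc : ℤ) • Y + toSite v) =
        comp (cVH • vhSAt (toSite r) 3 Lc rfl κ' u') (diagK (((1 : ℝ) / 2) • ∑ v ∈ box (3 + 1) Lc, legInd (toSite r) ((Lc : ℤ) • Y + toSite v)))
          - comp (diagK (((1 : ℝ) / 2) • ∑ v ∈ box (3 + 1) Lc, legInd (toSite r) ((Lc : ℤ) • Y + toSite v))) (cVH • vhSAt (toSite r) 3 Lc rfl κ' u')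
          + RB 0 Y κ' u')
    (hBord0'' : ∀ (Y : Fin (3 + 1) → ℤ) (κ : Fin (3 + 1)) (u : Fin (3 + 1) → ℤ),
      (stepScale 3 Lc 0 * (Lc : ℝ) ^ (3 + 1))⁻¹ • ∑ v ∈ box (3 + 1) Lc, divV (fun κ' u' => cB • vh₂S κ u κ' u') ((Lc : ℤ) • Y + toSite v) =
        comp (cVH • vhSAt (toSite r) 3 Lc rfl κ u) (diagK (((1 : ℝ) / 2) • ∑ v ∈ box (3 + 1) Lc, legInd (toSite r) ((Lc : ℤ) • Y + toSite v)))
          - comp (diagK (((1 : ℝ) / 2) • ∑ v ∈ box (3 + 1) Lc, legInd (toSite r) ((Lc : ℤ) • Y + toSite v))) (cVH • vhSAt (toSite r) 3 Lc rfl κ u)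
          + RB'' 0 Y κ u)
    (hBordS : ∀ (j : ℕ) (Y : Fin (3 + 1) → ℤ) (κ' : Fin (3 + 1)) (u' : Fin (3 + 1) → ℤ),
      (stepScale 3 Lc (j + 1) * (Lc : ℝ) ^ (3 + 1))⁻¹ •
          ∑ v ∈ box (3 + 1) Lc, divV (fun κ u => (cB * wB2 3 Lc (j + 1)) • vh₂S κ u κ' u') ((Lc : ℤ) • Y + toSite v) =
        comp ((cVH * wVH 3 Lc (j + 1)) • vhSAt (toSite r) 3 Lc rfl κ' u') (diagK (((1 : ℝ) / 2) • ∑ v ∈ box (3 + 1) Lc, legInd (toSite r) ((Lc : ℤ) • Y + toSite v)))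
          - comp (diagK (((1 : ℝ) / 2) • ∑ v ∈ box (3 + 1) Lc, legInd (toSite r) ((Lc : ℤ) • Y + toSite v))) ((cVH * wVH 3 Lc (j + 1)) • vhSAt (toSite r) 3 Lc rfl κ' u')
          + RB (j + 1) Y κ' u')
    (hBordS'' : ∀ (j : ℕ) (Y : Fin (3 + 1) → ℤ) (κ : Fin (3 + 1)) (u : Fin (3 + 1) → ℤ),
      (stepScale 3 Lc (j + 1) * (Lc : ℝ) ^ (3 + 1))⁻¹ •
          ∑ v ∈ box (3 + 1) Lc, divV (fun κ' u' => (cB * wB2 3 Lc (j + 1)) • vh₂S κ u κ' u') ((Lc : ℤ) • Y + toSite v) =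
        comp ((cVH * wVH 3 Lc (j + 1)) • vhSAt (toSite r) 3 Lc rfl κ u) (diagK (((1 : ℝ) / 2) • ∑ v ∈ box (3 + 1) Lc, legInd (toSite r) ((Lc : ℤ) • Y + toSite v)))
          - comp (diagK (((1 : ℝ) / 2) • ∑ v ∈ box (3 + 1) Lc, legInd (toSite r) ((Lc : ℤ) • Y + toSite v))) ((cVH * wVH 3 Lc (j + 1)) • vhSAt (toSite r) 3 Lc rfl κ u)
          + RB'' (j + 1) Y κ u)
    (hM₂ : ∀ (j : ℕ) (y : Fin (3 + 1) → ℤ) (ρ' : Fin (3 + 1)) (w : Fin (3 + 1) → ℤ),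
      (stepScale 3 Lc j * (Lc : ℝ) ^ (3 + 1))⁻¹ • ∑ v ∈ box (3 + 1) Lc, divV (fun κ u => M2Of 3 Lc (mixFFAt (toSite r) Lc) j κ u ρ' w) ((Lc : ℤ) • y + toSite v) =
        comp (M1At 3 Lc (toSite r) cΛ j ρ' w) (diagK (((1 : ℝ) / 2) • ∑ v ∈ box (3 + 1) Lc, legInd (toSite r) ((Lc : ℤ) • y + toSite v)))
          - comp (diagK (((1 : ℝ) / 2) • ∑ v ∈ box (3 + 1) Lc, legInd (toSite r) ((Lc : ℤ) • y + toSite v))) (M1At 3 Lc (toSite r) cΛ j ρ' w)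
          + RM j y ρ' w)
    {CL₁ CL₂ CL₁' CL₂' θL δ : ℝ} (hδ : 0 < δ) (hθL0 : 0 ≤ θL) (hθL1 : θL < 1)
    (hL₁ : ∀ l, LocStencil₂ (fun κ u κ' u' => fun (p z : Fin (3 + 1) → ℤ) (_ : Fib 3) (b : Fib 3) =>
      ∑ β : Fin (3 + 1), ((((1 : ℝ) / 2) • (unitS₂ (sfStep Lc l) (smStep 3 Lc l) (T2RecAt 3 Lc (toSite r) cE cVH cΛ cE₂ cB Tc vh₂S (mixFFAt (toSite r) Lc) l)
        + (1 : ℝ) • fun κ u κ' u' => sgnK (trK ((unitS₂ (sfStep Lc l) (smStep 3 Lc l) (T2RecAt 3 Lc (toSite r) cE cVH cΛ cE₂ cB Tc vh₂S (mixFFAt (toSite r) Lc) l))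
          κ u κ' u')))) κ u κ' u' p z (Sum.inl β) b
        - (((1 : ℝ) / 2) • (unitS₂ (sfStep Lc l) (smStep 3 Lc l) (T2RecAt 3 Lc (toSite r) cE cVH cΛ cE₂ cB Tc vh₂S (mixFFAt (toSite r) Lc) l)
        + (1 : ℝ) • fun κ u κ' u' => sgnK (trK ((unitS₂ (sfStep Lc l) (smStep 3 Lc l) (T2RecAt 3 Lc (toSite r) cE cVH cΛ cE₂ cB Tc vh₂S (mixFFAt (toSite r) Lc) l))
          κ u κ' u')))) κ u κ' u' (p - unitVec β) z (Sum.inl β) b)) CL₁ δ)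
    (hL₂ : ∀ l, LocStencil₂ (fun κ u κ' u' => fun (x p : Fin (3 + 1) → ℤ) (a : Fib 3) (_ : Fib 3) =>
      ∑ β : Fin (3 + 1), ((((1 : ℝ) / 2) • (unitS₂ (sfStep Lc l) (smStep 3 Lc l) (T2RecAt 3 Lc (toSite r) cE cVH cΛ cE₂ cB Tc vh₂S (mixFFAt (toSite r) Lc) l)
        + (1 : ℝ) • fun κ u κ' u' => sgnK (trK ((unitS₂ (sfStep Lc l) (smStep 3 Lc l) (T2RecAt 3 Lc (toSite r) cE cVH cΛ cE₂ cB Tc vh₂S (mixFFAt (toSite r) Lc) l))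
          κ u κ' u')))) κ u κ' u' x p a (Sum.inl β)
        - (((1 : ℝ) / 2) • (unitS₂ (sfStep Lc l) (smStep 3 Lc l) (T2RecAt 3 Lc (toSite r) cE cVH cΛ cE₂ cB Tc vh₂S (mixFFAt (toSite r) Lc) l)
        + (1 : ℝ) • fun κ u κ' u' => sgnK (trK ((unitS₂ (sfStep Lc l) (smStep 3 Lc l) (T2RecAt 3 Lc (toSite r) cE cVH cΛ cE₂ cB Tc vh₂S (mixFFAt (toSite r) Lc) l))
          κ u κ' u')))) κ u κ' u' x (p - unitVec β) a (Sum.inl β))) CL₂ δ)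
    (hL₁' : ∀ l, LocStencil₂ (fun κ u κ' u' => fun (p z : Fin (3 + 1) → ℤ) (_ : Fib 3) (b : Fib 3) =>
      ∑ β : Fin (3 + 1), (((((1 : ℝ) / 2) • (unitS₂ (sfStep Lc (l + 1)) (smStep 3 Lc (l + 1)) (T2RecAt 3 Lc (toSite r) cE cVH cΛ cE₂ cB Tc vh₂S (mixFFAt (toSite r) Lc) (l + 1))
        + (1 : ℝ) • fun κ u κ' u' => sgnK (trK ((unitS₂ (sfStep Lc (l + 1)) (smStep 3 Lc (l + 1)) (T2RecAt 3 Lc (toSite r) cE cVH cΛ cE₂ cB Tc vh₂S (mixFFAt (toSite r) Lc) (l + 1)))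
          κ u κ' u'))))
        - (((1 : ℝ) / 2) • (unitS₂ (sfStep Lc l) (smStep 3 Lc l) (T2RecAt 3 Lc (toSite r) cE cVH cΛ cE₂ cB Tc vh₂S (mixFFAt (toSite r) Lc) l)
        + (1 : ℝ) • fun κ u κ' u' => sgnK (trK ((unitS₂ (sfStep Lc l) (smStep 3 Lc l) (T2RecAt 3 Lc (toSite r) cE cVH cΛ cE₂ cB Tc vh₂S (mixFFAt (toSite r) Lc) l))
          κ u κ' u'))))) κ u κ' u' p z (Sum.inl β) b
        - ((((1 : ℝ) / 2) • (unitS₂ (sfStep Lc (l + 1)) (smStep 3 Lc (l + 1)) (T2RecAt 3 Lc (toSite r) cE cVH cΛ cE₂ cB Tc vh₂S (mixFFAt (toSite r) Lc) (l + 1))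
        + (1 : ℝ) • fun κ u κ' u' => sgnK (trK ((unitS₂ (sfStep Lc (l + 1)) (smStep 3 Lc (l + 1)) (T2RecAt 3 Lc (toSite r) cE cVH cΛ cE₂ cB Tc vh₂S (mixFFAt (toSite r) Lc) (l + 1)))
          κ u κ' u'))))
        - (((1 : ℝ) / 2) • (unitS₂ (sfStep Lc l) (smStep 3 Lc l) (T2RecAt 3 Lc (toSite r) cE cVH cΛ cE₂ cB Tc vh₂S (mixFFAt (toSite r) Lc) l)
        + (1 : ℝ) • fun κ u κ' u' => sgnK (trK ((unitS₂ (sfStep Lc l) (smStep 3 Lc l) (T2RecAt 3 Lc (toSite r) cE cVH cΛ cE₂ cB Tc vh₂S (mixFFAt (toSite r) Lc) l))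
          κ u κ' u'))))) κ u κ' u' (p - unitVec β) z (Sum.inl β) b)) (CL₁' * θL ^ l) δ)
    (hL₂' : ∀ l, LocStencil₂ (fun κ u κ' u' => fun (x p : Fin (3 + 1) → ℤ) (a : Fib 3) (_ : Fib 3) =>
      ∑ β : Fin (3 + 1), (((((1 : ℝ) / 2) • (unitS₂ (sfStep Lc (l + 1)) (smStep 3 Lc (l + 1)) (T2RecAt 3 Lc (toSite r) cE cVH cΛ cE₂ cB Tc vh₂S (mixFFAt (toSite r) Lc) (l + 1))
        + (1 : ℝ) • fun κ u κ' u' => sgnK (trK ((unitS₂ (sfStep Lc (l + 1)) (smStep 3 Lc (l + 1)) (T2RecAt 3 Lc (toSite r) cE cVH cΛ cE₂ cB Tc vh₂S (mixFFAt (toSite r) Lc) (l + 1)))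
          κ u κ' u'))))
        - (((1 : ℝ) / 2) • (unitS₂ (sfStep Lc l) (smStep 3 Lc l) (T2RecAt 3 Lc (toSite r) cE cVH cΛ cE₂ cB Tc vh₂S (mixFFAt (toSite r) Lc) l)
        + (1 : ℝ) • fun κ u κ' u' => sgnK (trK ((unitS₂ (sfStep Lc l) (smStep 3 Lc l) (T2RecAt 3 Lc (toSite r) cE cVH cΛ cE₂ cB Tc vh₂S (mixFFAt (toSite r) Lc) l))
          κ u κ' u'))))) κ u κ' u' x p a (Sum.inl β)
        - ((((1 : ℝ) / 2) • (unitS₂ (sfStep Lc (l + 1)) (smStep 3 Lc (l + 1)) (T2RecAt 3 Lc (toSite r) cE cVH cΛ cE₂ cB Tc vh₂S (mixFFAt (toSite r) Lc) (l + 1))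
        + (1 : ℝ) • fun κ u κ' u' => sgnK (trK ((unitS₂ (sfStep Lc (l + 1)) (smStep 3 Lc (l + 1)) (T2RecAt 3 Lc (toSite r) cE cVH cΛ cE₂ cB Tc vh₂S (mixFFAt (toSite r) Lc) (l + 1)))
          κ u κ' u'))))
        - (((1 : ℝ) / 2) • (unitS₂ (sfStep Lc l) (smStep 3 Lc l) (T2RecAt 3 Lc (toSite r) cE cVH cΛ cE₂ cB Tc vh₂S (mixFFAt (toSite r) Lc) l)
        + (1 : ℝ) • fun κ u κ' u' => sgnK (trK ((unitS₂ (sfStep Lc l) (smStep 3 Lc l) (T2RecAt 3 Lc (toSite r) cE cVH cΛ cE₂ cB Tc vh₂S (mixFFAt (toSite r) Lc) l))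
          κ u κ' u'))))) κ u κ' u' x (p - unitVec β) a (Sum.inl β))) (CL₂' * θL ^ l) δ)
    (hS : ∀ (i : ℕ) (κ κ' κ₁ κ₂ : Fin (3 + 1)),
      zmode Lc (unitS₂ (sfStep Lc i) (smStep 3 Lc i) (T2RecAt 3 Lc (toSite r) cE cVH cΛ cE₂ cB Tc vh₂S (mixFFAt (toSite r) Lc) i)) κ κ' (Sum.inl κ₁) (Sum.inl κ₂)
        + zmode Lc (unitS₂ (sfStep Lc i) (smStep 3 Lc i) (T2RecAt 3 Lc (toSite r) cE cVH cΛ cE₂ cB Tc vh₂S (mixFFAt (toSite r) Lc) i)) κ' κ (Sum.inl κ₁) (Sum.inl κ₂)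
        = zmode Lc (unitS₂ (sfStep Lc i) (smStep 3 Lc i) (T2RecOf 3 Lc (fun j => KInvStep (d := 3) Lc j) (SpureRecAt 3 Lc (toSite r) cE cVH cΛ) (M1At 3 Lc (toSite r) cΛ) cE₂ cB Tc vh₂S (mixFFAt (toSite r) Lc) i)) κ κ' (Sum.inl κ₁) (Sum.inl κ₂)
        + zmode Lc (unitS₂ (sfStep Lc i) (smStep 3 Lc i) (T2RecOf 3 Lc (fun j => KInvStep (d := 3) Lc j) (SpureRecAt 3 Lc (toSite r) cE cVH cΛ) (M1At 3 Lc (toSite r) cΛ) cE₂ cB Tc vh₂S (mixFFAt (toSite r) Lc) i)) κ' κ (Sum.inl κ₁) (Sum.inl κ₂))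
    (μ ν : Fin 4) :
    ∃ κ θ : ℝ, 0 ≤ θ ∧ θ < 1 ∧ AllScalesSeq (fun j => B12Beta.secondMoment (TbalOf Lc (JsRowD1Pin hLc N) j) μ ν) κ θ := by
  have hL3 : 3 ≤ Lc := by obtain ⟨k, hk⟩ := hLc; omega
  have hLc1 : 1 ≤ Lc := by omega
  have hr' : r ∈ box (3 + 1) Lc := hr ▸ ctrOff_mem_box (by omega)
  subst hcE hcVH hTc hvh
  -- the border's class (d1-leaf-06) and the mixed table's class (an1) at the literal's tables
  obtain ⟨CB, δB, hδB, hB⟩ := locStencil₂_vh₂SAn1 hLc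
  have hmix : ∃ C δ : ℝ, 0 < δ ∧ LocStencilFM Lc (mixFFAt (toSite r) Lc) C δ := hmix_an1 hLc1 hr'
  -- THE ALL-LEVELS KERNEL LAW OF THE W-LITERAL WITH ITS RESIDUAL TOWER (the chair g38 ⨾ g44 ⨾ leaf-01 g71), Wilson letters discharged (SU(N), N ≥ 2)
  obtain ⟨Φ, Ψ, -, -, -, -, hclsN, hLAW, hPΨ, hPΦ, -, -, -⟩ :=
    exists_kernelLaws_vertexForm_parity_TW_su hLc1 hr' cΛ cB hcE₂ hN ⟨CB, δB, hδB, hB⟩ hmix hcls0 hclsS hRBp hRB''p hRMp hBord0 hBord0'' hBordS hBordS'' hM₂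
  -- the residual `𝒩_m := vertexOfK G_m (Φ m ·) + Ψ m` of the level-`m` kernel law: localised, row-parity-odd
  have h𝒩 : ∀ (m : ℕ) (y : Fin (3 + 1) → ℤ) (ν : Fin (3 + 1)) (y' : Fin (3 + 1) → ℤ),
      Loc (vertexOfK (coDressKBmAt (toSite r) Lc (KInvStep (d := 3) Lc m)) Lc (Φ m y) ν y' + Ψ m y ν y') := fun m y ν y' => by
    obtain ⟨C, δ, hδ, hV⟩ := hclsN m
    exact ⟨_, _, _, δ, hδ, hV y ν y'⟩
  have h𝒩par : ∀ (m : ℕ) (y : Fin (3 + 1) → ℤ) (ν : Fin (3 + 1)) (y' : Fin (3 + 1) → ℤ),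
      trK (vertexOfK (coDressKBmAt (toSite r) Lc (KInvStep (d := 3) Lc m)) Lc (Φ m y) ν y' + Ψ m y ν y') = -sgnK (vertexOfK (coDressKBmAt (toSite r) Lc (KInvStep (d := 3) Lc m)) Lc (Φ m y) ν y' + Ψ m y ν y') :=
    fun m y ν y' => parityOdd_add (trK_vertexOfK_eq_neg_sgnK_of_rows _ (hPΦ m y) ν y') (hPΨ m y ν y')
  have hKs : ∀ m : ℕ, Spr (coDressKBmAt (toSite r) Lc (KInvStep (d := 3) Lc m)) := fun m => spr_of_decays (decays_coDressKBmAt_KInvStep (d := 3) hr' m)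
  have hKt : ∀ m : ℕ, trK (coDressKBmAt (toSite r) Lc (KInvStep (d := 3) Lc m)) = sgnK (coDressKBmAt (toSite r) Lc (KInvStep (d := 3) Lc m)) := fun m => trK_coDressKBmAt_KInvStep (d := 3) hr' m
  -- D1's RAW TABLE LAWS at every level: level 0 from the Wilson letters (theorems) + `hBord0 ∕ ''`; level m+1 from the level-m kernel law + the PINNED lock + `hBordS ∕ ''`
  have hT0 := tableLaw_T2RecAt_zero (r := r) cΛ cE₂ cB ((8 * (N : ℝ) ^ 2)⁻¹ • wsym22 N) (vh₂SAn1 Lc) (mixFFAt (toSite r) Lc)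
    (hWil_wilson_TW_su hN Lc r hcE₂) hBord0
  have hT0'' := tableLaw_T2RecAt_zero'' (r := r) cΛ cE₂ cB ((8 * (N : ℝ) ^ 2)⁻¹ • wsym22 N) (vh₂SAn1 Lc) (mixFFAt (toSite r) Lc)
    (hWil''_wilson_TW_su hN Lc r hcE₂) hBord0''
  have hTS := fun m : ℕ => tableLaw_T2RecAt_succ hLc1 hr' cΛ cE₂ cB ((8 * (N : ℝ) ^ 2)⁻¹ • wsym22 N) ⟨CB, δB, hδB, hB⟩ hmix m (h𝒩 m) (hLAW m)
    (lock_succ_of_pin hLc1 hcE₂ m) (hBordS m)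
  have hTS'' := fun m : ℕ => tableLaw_T2RecAt_succ'' hLc1 hr' cΛ cE₂ cB ((8 * (N : ℝ) ^ 2)⁻¹ • wsym22 N) ⟨CB, δB, hδB, hB⟩ hmix m (h𝒩 m) (hLAW m)
    (lock_succ_of_pin hLc1 hcE₂ m) (hBordS'' m)
  subst hcE₂
  -- PART D at the pinned lock constants (INTENT 2's pin), the residual words := (table law's left side) − (commutator word): `hTL ∕ hTL''` are then identities,
  -- and their parities are read off D1's table laws level by level
  refine exists_allScalesSeq_JsRowD1Pin_of_wardLetters hLc hL2 N hr (by norm_num) (by ring) hcΛ (by norm_num) hcB rfl rfl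
    (cH := fun l => (stepScale 3 Lc l * (Lc : ℝ) ^ (3 + 1))⁻¹)
    (R := fun l Y κ' u' =>
      (stepScale 3 Lc l * (Lc : ℝ) ^ (3 + 1))⁻¹ • ∑ v ∈ box (3 + 1) Lc, divV (fun κ u => T2RecAt 3 Lc (toSite r) ((Lc : ℝ) ^ (3 + 1)) (-((Lc : ℝ) ^ (3 + 1) * (1 / 2) * (Lc : ℝ) ^ (3 + 1))) cΛ ((Lc : ℝ) ^ (2 * (3 + 1))) cB ((8 * (N : ℝ) ^ 2)⁻¹ • wsym22 N) (vh₂SAn1 Lc) (mixFFAt (toSite r) Lc) l κ u κ' u') ((Lc : ℤ) • Y + toSite v)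
        - (comp (SpureRecAt 3 Lc (toSite r) ((Lc : ℝ) ^ (3 + 1)) (-((Lc : ℝ) ^ (3 + 1) * (1 / 2) * (Lc : ℝ) ^ (3 + 1))) cΛ l κ' u') (diagK (((1 : ℝ) / 2) • ∑ v ∈ box (3 + 1) Lc, legInd (toSite r) ((Lc : ℤ) • Y + toSite v))) - comp (diagK (((1 : ℝ) / 2) • ∑ v ∈ box (3 + 1) Lc, legInd (toSite r) ((Lc : ℤ) • Y + toSite v))) (SpureRecAt 3 Lc (toSite r) ((Lc : ℝ) ^ (3 + 1)) (-((Lc : ℝ) ^ (3 + 1) * (1 / 2) * (Lc : ℝ) ^ (3 + 1))) cΛ l κ' u')))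
    (R'' := fun l Y κ u =>
      (stepScale 3 Lc l * (Lc : ℝ) ^ (3 + 1))⁻¹ • ∑ v ∈ box (3 + 1) Lc, divV (T2RecAt 3 Lc (toSite r) ((Lc : ℝ) ^ (3 + 1)) (-((Lc : ℝ) ^ (3 + 1) * (1 / 2) * (Lc : ℝ) ^ (3 + 1))) cΛ ((Lc : ℝ) ^ (2 * (3 + 1))) cB ((8 * (N : ℝ) ^ 2)⁻¹ • wsym22 N) (vh₂SAn1 Lc) (mixFFAt (toSite r) Lc) l κ u) ((Lc : ℤ) • Y + toSite v)
        - (comp (SpureRecAt 3 Lc (toSite r) ((Lc : ℝ) ^ (3 + 1)) (-((Lc : ℝ) ^ (3 + 1) * (1 / 2) * (Lc : ℝ) ^ (3 + 1))) cΛ l κ u) (diagK (((1 : ℝ) / 2) • ∑ v ∈ box (3 + 1) Lc, legInd (toSite r) ((Lc : ℤ) • Y + toSite v))) - comp (diagK (((1 : ℝ) / 2) • ∑ v ∈ box (3 + 1) Lc, legInd (toSite r) ((Lc : ℤ) • Y + toSite v))) (SpureRecAt 3 Lc (toSite r) ((Lc : ℝ) ^ (3 + 1)) (-((Lc : ℝ)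 ^ (3 + 1) * (1 / 2) * (Lc : ℝ) ^ (3 + 1))) cΛ l κ u)))
    hcH0_pin_three hcH_pin_three (fun l Y κ' u' => (add_sub_cancel _ _).symm) (fun l Y κ u => (add_sub_cancel _ _).symm) ?_ ?_
    hq_pin_three hδ hθL0 hθL1 hL₁ hL₂ hL₁' hL₂' hS μ ν
  · intro l Y κ' u'
    cases l with
    | zero =>
      simp only [hT0 Y κ' u', add_sub_cancel_left]
      exact parityOdd_add (parityOdd_zero_family Y κ' u') (hRBp 0 Y κ' u')
    | succ m =>
      simp only [hTS m Y κ' u', add_sub_cancel_left]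
      exact parityOdd_add (parityOdd_smul _ (parityOdd_sum _ fun v _ =>
        parityOdd_mmRead Lc (parityOdd_sandwich (hKs m) (h𝒩 m _ κ' u') (hKt m) (h𝒩par m _ κ' u')))) (hRBp (m + 1) Y κ' u')
  · intro l Y κ u
    cases l with
    | zero =>
      simp only [hT0'' Y κ u, add_sub_cancel_left]
      exact parityOdd_add (parityOdd_zero_family Y κ u) (hRB''p 0 Y κ u)
    | succ m =>
      simp only [hTS'' m Y κ u, add_sub_cancel_left]
      exact parityOdd_add (parityOdd_smul _ (parityOdd_sum _ fun v _ =>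
        parityOdd_mmRead Lc (parityOdd_sandwich (hKs m) (h𝒩 m _ κ u) (hKt m) (h𝒩par m _ κ u)))) (hRB''p (m + 1) Y κ u)

end Summit.QuantumFields.BalabanUV.Beta.GAN24.WrecAtEvenHalfRowsOfBorderLetters

end
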